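import Summits.NavierStokesRegularity.NavierStokesRegularity.Theorems.GaldiLiouvilleGateAllAxesSmoothSteps
import HarnessLib

/-!
# Galdi's Liouville problem ⟨0895⟩, line «all-axes cylinder budget», piece O1c (3/·):
# the radial profile of the ONE-STROKE test function `ψ = χ(x₃) · M(x₁² + x₂²)`

Route `GaldiLiouvilleGate` (NavierStokesRegularity), items ⟨0895⟩/⟨0896⟩; LINE allaxes/cylbudget, combined
Defs v3.1 (pub/ideators/ns-idea-4/lines/combined/CylinderBudgets_v3_1.lean 817120c4c833a18a), obligation
O1c′ `CylinderBookkeepingSplit` (BLUEPRINT Remark 15, «the tested identity with ψ = G(r)χ(z/L) and the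
profile G′ = r ∧ t²/r, tapered on [R, 2R]»).  Pure one-variable calculus, no fluid content:

* `exists_radialProfile` — for `0 < ε ≤ t`, `2(t+ε) ≤ T`, `c₁ = (t+ε)²`: a smooth pair `(N, M)` with
  `M′ = N/2`, `N = 1` on `s ≤ t²`, `N = c₁/s`, `N′ = −c₁/s²` on `[c₁, T²]`, `N = N′ = M = 0` on
  `s ≥ 4T²`, `0 ≤ N ≤ 4`, `N′ ≤ 0` on `s ≥ c₁`, crude bounds `|sN′|, |N + sN′| ≤ A` on the transition
  `[t², c₁]` with `A` ABSOLUTE (the kink profile `min(1, t²/s)` is the only one with `ε = 0` — hence the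
  transition layer, paid later by `∫_{t<r<t+ε}|P−c| → 0`), on the taper `[T², 4T²]`:
  `|N + sN′| ≤ A c₁/T²`, `0 ≤ −s²N′ ≤ A c₁`; and `|M| ≤ A T²` on `s ≥ 0`.

[folklore]  No summit / no ⟨0895⟩–⟨0896⟩ claim is proved here; NS regularity is not touched.
-/

noncomputable section

-- the problem directory repeats the summit name (D-0017); core's `dupNamespace` linter fires
set_option linter.dupNamespace false

open MeasureTheory Set Filter Topology Function
open scoped Topology Interval

namespace Summit.NavierStokesRegularity.NavierStokesRegularity.Theorems.GaldiLiouville.AllAxesBudget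

open Literature.Analysis.Calculus

/-- **The radial profile of the one-stroke test function.**  There is an absolute `A ≥ 0` such that for
all `0 < ε ≤ t` and `T ≥ 2(t+ε)`, with `c₁ = (t+ε)²`, there are smooth `N, M : ℝ → ℝ` with `M′ = N/2` and:
`N = 1` on `s ≤ t²` (`N′ = 0` on `s < t²`); `N = c₁/s`, `N′ = −c₁/s²` on `[c₁, T²]`; `N = N′ = M = 0` on
`s ≥ 4T²`; `0 ≤ N ≤ 4` on `s ≥ 0`; `N′ ≤ 0` on `s ≥ c₁`; on the transition `[t², c₁]`:
`|sN′| ≤ A`, `|N + sN′| ≤ A`; on the taper `[T², 4T²]`: `|N + sN′| ≤ A c₁/T²`,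
`0 ≤ −s²N′ ≤ A c₁`; and `|M| ≤ A T²` on `s ≥ 0`.  (`N = [φ + (1−φ)c₁/s]·η` with smooth steps
`φ = sT((c₁−s)/(c₁−t²))`, `η = sT((4T²−s)/(3T²))`, `M(s) = ½∫_{4T²}^{s} N`.) [folklore] -/
theorem exists_radialProfile : ∃ A : ℝ, 0 ≤ A ∧ ∀ (t ε T : ℝ), 0 < t → 0 < ε → ε ≤ t → 2 * (t + ε) ≤ T →
    ∃ N M : ℝ → ℝ, ContDiff ℝ (⊤ : ℕ∞) N ∧ ContDiff ℝ (⊤ : ℕ∞) M ∧ (∀ s, HasDerivAt M (N s / 2) s) ∧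
      (∀ s, s ≤ t ^ 2 → N s = 1) ∧ (∀ s, s < t ^ 2 → deriv N s = 0) ∧
      (∀ s, (t + ε) ^ 2 ≤ s → s ≤ T ^ 2 → N s = (t + ε) ^ 2 / s ∧ deriv N s = -((t + ε) ^ 2 / s ^ 2)) ∧
      (∀ s, 4 * T ^ 2 ≤ s → N s = 0 ∧ deriv N s = 0 ∧ M s = 0) ∧
      (∀ s, 0 ≤ s → 0 ≤ N s ∧ N s ≤ 4) ∧
      (∀ s, (t + ε) ^ 2 ≤ s → deriv N s ≤ 0) ∧
      (∀ s, t ^ 2 ≤ s → s ≤ (t + ε) ^ 2 → |s * deriv N s| ≤ A ∧ |N s + s * deriv N s| ≤ A) ∧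
      (∀ s, T ^ 2 ≤ s → s ≤ 4 * T ^ 2 →
        |N s + s * deriv N s| ≤ A * (t + ε) ^ 2 / T ^ 2 ∧ 0 ≤ -(s ^ 2 * deriv N s) ∧
          -(s ^ 2 * deriv N s) ≤ A * (t + ε) ^ 2) ∧
      (∀ s, 0 ≤ s → |M s| ≤ A * T ^ 2) := by
  obtain ⟨D, hD0, hD1, -⟩ := exists_bound_deriv_deriv_smoothTransition
  refine ⟨2 * D + 8, by positivity, ?_⟩
  intro t ε T ht hε hεt hT
  -- ### constants
  set c₁ : ℝ := (t + ε) ^ 2 with hc₁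
  set d : ℝ := c₁ - t ^ 2 with hd
  have hd0 : 0 < d := by rw [hd, hc₁]; nlinarith
  have hc₁4 : c₁ ≤ 4 * t ^ 2 := by rw [hc₁]; nlinarith
  have ht2 : 0 < t ^ 2 := by positivity
  have hc₁0 : 0 < c₁ := by positivity
  have hT0 : 0 < T := by linarith
  have hT2 : 0 < T ^ 2 := by positivity
  have hcT : c₁ ≤ T ^ 2 := by rw [hc₁]; nlinarith
  -- ### the two smooth steps
  set φ : ℝ → ℝ := fun s => Real.smoothTransition ((c₁ - s) / d) with hφ
  set η : ℝ → ℝ := fun s => Real.smoothTransition ((4 * T ^ 2 - s) / (3 * T ^ 2)) with hη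
  have hφC : ContDiff ℝ (⊤ : ℕ∞) φ :=
    Real.smoothTransition.contDiff.comp ((contDiff_const.sub contDiff_id).div_const _)
  have hηC : ContDiff ℝ (⊤ : ℕ∞) η :=
    Real.smoothTransition.contDiff.comp ((contDiff_const.sub contDiff_id).div_const _)
  have hφ01 : ∀ s, 0 ≤ φ s ∧ φ s ≤ 1 := fun s =>
    ⟨Real.smoothTransition.nonneg _, Real.smoothTransition.le_one _⟩
  have hη01 : ∀ s, 0 ≤ η s ∧ η s ≤ 1 := fun s =>
    ⟨Real.smoothTransition.nonneg _, Real.smoothTransition.le_one _⟩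
  have hφ1 : ∀ s, s ≤ t ^ 2 → φ s = 1 := fun s hs =>
    Real.smoothTransition.one_of_one_le ((one_le_div hd0).2 (by rw [hd]; linarith))
  have hφ0 : ∀ s, c₁ ≤ s → φ s = 0 := fun s hs =>
    Real.smoothTransition.zero_of_nonpos (div_nonpos_of_nonpos_of_nonneg (by linarith) hd0.le)
  have hη1 : ∀ s, s ≤ T ^ 2 → η s = 1 := fun s hs =>
    Real.smoothTransition.one_of_one_le ((one_le_div (by positivity)).2 (by linarith))
  have hη0 : ∀ s, 4 * T ^ 2 ≤ s → η s = 0 := fun s hs =>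
    Real.smoothTransition.zero_of_nonpos (div_nonpos_of_nonpos_of_nonneg (by linarith) (by positivity))
  have hφd : ∀ s, HasDerivAt φ (deriv Real.smoothTransition ((c₁ - s) / d) * (-1 / d)) s := fun s =>
    hasDerivAt_smoothTransition_affine c₁ d s
  have hηd : ∀ s, HasDerivAt η (deriv Real.smoothTransition ((4 * T ^ 2 - s) / (3 * T ^ 2)) * (-1 / (3 * T ^ 2))) s :=
    fun s => hasDerivAt_smoothTransition_affine (4 * T ^ 2) (3 * T ^ 2) s
  have hφd0_hi : ∀ s, c₁ ≤ s → deriv φ s = 0 := fun s hs => by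
    rw [(hφd s).deriv, deriv_smoothTransition_of_nonpos (div_nonpos_of_nonpos_of_nonneg (by linarith) hd0.le),
      zero_mul]
  have hηd0_lo : ∀ s, s ≤ T ^ 2 → deriv η s = 0 := fun s hs => by
    rw [(hηd s).deriv, deriv_smoothTransition_of_one_le ((one_le_div (by positivity)).2 (by linarith)), zero_mul]
  have hηd0_hi : ∀ s, 4 * T ^ 2 ≤ s → deriv η s = 0 := fun s hs => by
    rw [(hηd s).deriv, deriv_smoothTransition_of_nonpos
      (div_nonpos_of_nonpos_of_nonneg (by linarith) (by positivity)), zero_mul]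
  have hφd_bd : ∀ s, |deriv φ s| ≤ D / d := fun s => by
    have habs : |(-1 : ℝ) / d| = 1 / d := by rw [abs_div, abs_neg, abs_one, abs_of_pos hd0]
    rw [(hφd s).deriv, abs_mul, habs]
    calc |deriv Real.smoothTransition ((c₁ - s) / d)| * (1 / d) ≤ D * (1 / d) :=
          mul_le_mul_of_nonneg_right (hD1 _) (by positivity)
      _ = D / d := by ring
  have hηd_np : ∀ s, deriv η s ≤ 0 := fun s => by
    rw [(hηd s).deriv]
    exact mul_nonpos_of_nonneg_of_nonpos Real.smoothTransition.monotone.deriv_nonneg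
      (div_nonpos_of_nonpos_of_nonneg (by norm_num) (by positivity))
  have hηd_bd : ∀ s, |deriv η s| ≤ D / (3 * T ^ 2) := fun s => by
    have habs : |(-1 : ℝ) / (3 * T ^ 2)| = 1 / (3 * T ^ 2) := by
      rw [abs_div, abs_neg, abs_one, abs_of_pos (by positivity)]
    rw [(hηd s).deriv, abs_mul, habs]
    calc |deriv Real.smoothTransition ((4 * T ^ 2 - s) / (3 * T ^ 2))| * (1 / (3 * T ^ 2))
        ≤ D * (1 / (3 * T ^ 2)) := mul_le_mul_of_nonneg_right (hD1 _) (by positivity)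
      _ = D / (3 * T ^ 2) := by ring
  -- ### the profile `N = (φ + (1 - φ) c₁/s) · η`
  set N : ℝ → ℝ := fun s => (φ s + (1 - φ s) * (c₁ / s)) * η s with hN
  -- smoothness: near points `> t²/2` every piece is smooth, near points `≤ t²/2` it is `≡ 1`
  have hN_lo : ∀ s, s ≤ t ^ 2 → N s = 1 := fun s hs => by
    simp only [hN, hφ1 s hs, hη1 s (by linarith)]; ring
  have hNC : ContDiff ℝ (⊤ : ℕ∞) N := by
    refine contDiff_iff_contDiffAt.2 fun s₀ => ?_
    by_cases hs₀ : t ^ 2 / 2 < s₀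
    · have hne : s₀ ≠ 0 := (lt_trans (by positivity) hs₀).ne'
      have hinv : ContDiffAt ℝ (⊤ : ℕ∞) (fun s : ℝ => c₁ / s) s₀ := by
        have e : (fun s : ℝ => c₁ / s) = fun s => c₁ * s⁻¹ := funext fun s => div_eq_mul_inv _ _
        rw [e]; exact contDiffAt_const.mul (contDiffAt_inv ℝ hne)
      exact (hφC.contDiffAt.add ((contDiffAt_const.sub hφC.contDiffAt).mul hinv)).mul hηC.contDiffAt
    · rw [not_lt] at hs₀
      have hev : N =ᶠ[𝓝 s₀] fun _ => (1 : ℝ) := by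
        filter_upwards [Iio_mem_nhds (show s₀ < t ^ 2 by linarith)] with s hs
        exact hN_lo s hs.le
      exact (contDiffAt_const.congr_of_eventuallyEq hev : ContDiffAt ℝ (⊤ : ℕ∞) N s₀)
  -- the derivative value
  have hNd : ∀ s, s ≠ 0 → HasDerivAt N
      ((deriv φ s + (-deriv φ s * (c₁ / s) + (1 - φ s) * (-(c₁ / s ^ 2)))) * η s +
        (φ s + (1 - φ s) * (c₁ / s)) * deriv η s) s := fun s hs =>
    hasDerivAt_radialN (hφd s).differentiableAt.hasDerivAt (hηd s).differentiableAt.hasDerivAt hs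
  have hNd_lo : ∀ s, s < t ^ 2 → deriv N s = 0 := fun s hs => by
    have hev : N =ᶠ[𝓝 s] fun _ => (1 : ℝ) := by
      filter_upwards [Iio_mem_nhds hs] with σ hσ
      exact hN_lo σ hσ.le
    rw [hev.deriv_eq, deriv_const]
  have hN_hi4 : ∀ s, 4 * T ^ 2 ≤ s → N s = 0 := fun s hs => by
    simp only [hN, hη0 s hs]; ring
  have hN04 : ∀ s, 0 ≤ s → 0 ≤ N s ∧ N s ≤ 4 := by
    intro s hs
    have hn0 : 0 ≤ φ s + (1 - φ s) * (c₁ / s) ∧ φ s + (1 - φ s) * (c₁ / s) ≤ 4 := by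
      by_cases hst : s ≤ t ^ 2
      · rw [hφ1 s hst]; norm_num
      · rw [not_le] at hst
        have hcs : c₁ / s ≤ 4 := by rw [div_le_iff₀ (by linarith)]; nlinarith
        have hcs0 : 0 ≤ c₁ / s := div_nonneg hc₁0.le hs
        obtain ⟨h0, h1⟩ := hφ01 s
        constructor <;> nlinarith
    obtain ⟨e0, e1⟩ := hη01 s
    exact ⟨mul_nonneg hn0.1 e0, by nlinarith [hn0.1, hn0.2]⟩
  -- ### the primitive
  obtain ⟨hMC, hMd, hM0, hMb⟩ := radialPrimitive_props hNC (by positivity : (0 : ℝ) ≤ 4 * T ^ 2) hN_hi4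
    (fun s hs => by rw [abs_of_nonneg (hN04 s hs).1]; exact (hN04 s hs).2)
  -- ### the derivative on `s ≥ c₁`: `φ = 0`, `φ′ = 0`
  have hNd_hi : ∀ s, c₁ ≤ s → deriv N s =
      (0 + (-0 * (c₁ / s) + (1 - 0) * (-(c₁ / s ^ 2)))) * η s + (0 + (1 - 0) * (c₁ / s)) * deriv η s :=
    fun s hs => by
    have hs0 : s ≠ 0 := (lt_of_lt_of_le hc₁0 hs).ne'
    rw [(hNd s hs0).deriv, hφ0 s hs, hφd0_hi s hs]
  refine ⟨N, fun s => 1 / 2 * ∫ σ in (4 * T ^ 2)..s, N σ, hNC, hMC, hMd, hN_lo, hNd_lo,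
    ?_, ?_, hN04, ?_, ?_, ?_, fun s hs => (hMb s hs).trans (by nlinarith)⟩
  · -- clean zone `[c₁, T²]`
    intro s hs hs'
    have hs0 : s ≠ 0 := (lt_of_lt_of_le hc₁0 hs).ne'
    refine ⟨by simp only [hN, hφ0 s hs, hη1 s hs']; ring, ?_⟩
    rw [hNd_hi s hs, hη1 s hs', hηd0_lo s hs']; ring
  · -- beyond `4T²`
    intro s hs
    have hsc : c₁ ≤ s := by linarith
    refine ⟨hN_hi4 s hs, ?_, hM0 s hs⟩
    rw [hNd_hi s hsc, hη0 s hs, hηd0_hi s hs]; ring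
  · -- `N′ ≤ 0` on `s ≥ c₁`
    intro s hs
    rw [hNd_hi s hs]
    have hs0 : 0 < s := lt_of_lt_of_le hc₁0 hs
    have h1 : 0 ≤ c₁ / s ^ 2 * η s := mul_nonneg (by positivity) (hη01 s).1
    have h2 : c₁ / s * deriv η s ≤ 0 := mul_nonpos_of_nonneg_of_nonpos (by positivity) (hηd_np s)
    nlinarith
  · -- transition `[t², c₁]`
    intro s hs hs'
    have hs0 : 0 < s := lt_of_lt_of_le ht2 hs
    have hsT : s ≤ T ^ 2 := hs'.trans hcT
    have hval : N s = (φ s + (1 - φ s) * (c₁ / s)) * 1 := by simp only [hN, hη1 s hsT]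
    have hder : deriv N s = (deriv φ s + (-deriv φ s * (c₁ / s) + (1 - φ s) * (-(c₁ / s ^ 2)))) * 1 +
        (φ s + (1 - φ s) * (c₁ / s)) * 0 := by
      rw [(hNd s hs0.ne').deriv, hη1 s hsT, hηd0_lo s hsT]
    have hDd : |deriv φ s * (s - c₁)| ≤ D := by
      rw [abs_mul]
      calc |deriv φ s| * |s - c₁| ≤ D / d * d := by
            refine mul_le_mul (hφd_bd s) ?_ (abs_nonneg _) (by positivity)
            rw [abs_of_nonpos (by linarith), hd]; linarith
        _ = D := by field_simp
    have hcs : c₁ / s ≤ 4 := by rw [div_le_iff₀ hs0]; nlinarith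
    obtain ⟨b1, b2⟩ := radialN_transition_arith hs0 (hφ01 s).1 (hφ01 s).2 hDd (by positivity) hcs
    rw [hder, hval]
    exact ⟨b1.trans (by linarith), b2.trans (by linarith)⟩
  · -- taper `[T², 4T²]`
    intro s hs hs'
    have hsc : c₁ ≤ s := hcT.trans hs
    have hval : N s = (0 + (1 - 0) * (c₁ / s)) * η s := by simp only [hN, hφ0 s hsc]
    obtain ⟨b1, b2, b3⟩ := radialN_taper_arith (D := D) hT0 hc₁0.le hs hs' (hη01 s).1 (hη01 s).2 (hηd_np s) (hηd_bd s)
    rw [hNd_hi s hsc, hval]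
    refine ⟨b1.trans ?_, b2, b3.trans ?_⟩
    · rw [le_div_iff₀ hT2]
      have : c₁ * (D / (3 * T ^ 2)) * T ^ 2 = c₁ * D / 3 := by field_simp
      rw [this]; nlinarith
    · nlinarith

end Summit.NavierStokesRegularity.NavierStokesRegularity.Theorems.GaldiLiouville.AllAxesBudget

end
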